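import Summits.RiemannHypothesis.RiemannHypothesis.Theorems.TiltedLandingLaw421R3QuadW
import Literature.Analysis.Complex.RoucheTheorem

/-! # TiltedLandingLaw421 — round 3q SUPPORT: the E2 REPLAY of the upper-model (Rouché) door, kernel-certified (W-08, C1 rh-idea-5 g28)

SUPPORT module (no stub, no crux, no `sorry`, no `EngineHyps5`). Nothing here bears on the truth of RH; the frame is a quartic×exponential
MODEL, not `ξ`; RH is not proved; 24774 OPEN.

WHAT. The smallest two-pair tilted frame of the W-08 numerics («E2», C6 `frames.py`):
`F₀ z = e^{−7z/2} · (z² + 9/25) · ((z − 6/5)² + 9/25)` (pairs `±3i/5` at `x₀ = 0` and `6/5 ± 3i/5`; column `R = 2`, strip `Hs = 3/5`).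
We CERTIFY IN KERNEL that `F₀′` has a zero `u` with `‖u − c‖ < 1/25`, `c = 1/5 + 11i/20`, and that `u` is a level-1 BAND STATE
`StTrkDQ η F₀ 0 s hmax 2 (3/5) B 1 u` for every `η s hmax B` (the class `StColQ'` reads only `f, x₀, R, Hs, j`).

HOW (the replay recipe of C1 g28 RESULT-2 (B), = the §U/§T door of `…R3ClusterQM(P)` with the exponential cancelled and a LINEAR model):
`F₀′ = e^{−7z/2}·D`, `D = P′ − (7/2)P = −7/2 z⁴ + 62/5 z³ − 369/25 z² + 918/125 z − 783/250`; synthetic division `D z = (z − c)·D₂ z + D c`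
(Horner coefficients `q₂ q₁ q₀` defined FROM `c`, so both identities are `ring`); Rouché on `‖z − c‖ = 1/25` for `f = F₀′` against
`g = (z − c)·e^{−7z/2}·D₂ z`: the defect is the CONSTANT `e^{−7z/2}·D(c)` and the certificate is the single inequality
`‖D c‖ (< 1/20) < (1/25)·min ‖D₂‖ (> 7/25)`, from `‖D₂(c + w)‖ ≥ ‖a₀‖ − ‖w‖(‖a₁‖ + ‖w‖(‖a₂‖ + (7/2)‖w‖))` with the exact rationals
`a₀ = −737/125 − 26587i/4000` (`‖a₀‖ > 8`), `a₁ = −723/400 + 396i/25` (`< 16`), `a₂ = 48/5 − 77i/10` (`< 13`), `D c = −3799/320000 − 121i/2500`.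
The tree's `Literature.Analysis.Complex.Rouche.existsUnique_zero_of_norm_sub_lt` (one simple zero) then gives the child, unique in the disc. -/

namespace RhW08.E2Replay

open Complex Set Metric
open Literature.Analysis.Complex
open RhW08.QuadW

/-! ## 1. The frame and its exact algebra -/

/-- the quartic `P` of E2 -/
noncomputable def P (z : ℂ) : ℂ := (z ^ 2 + 9 / 25) * ((z - 6 / 5) ^ 2 + 9 / 25)

/-- the frame `F₀ = e^{−7z/2} P` -/
noncomputable def F₀ (z : ℂ) : ℂ := cexp (-7 / 2 * z) * P z

/-- `D = P′ − (7/2) P` expanded -/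
noncomputable def D (z : ℂ) : ℂ := -7 / 2 * z ^ 4 + 62 / 5 * z ^ 3 - 369 / 25 * z ^ 2 + 918 / 125 * z - 783 / 250

/-- the Rouché centre `c = 1/5 + 11i/20` -/
noncomputable def c : ℂ := ⟨1 / 5, 11 / 20⟩

/-- Horner coefficients of the quotient `D₂ = (D − D c)/(z − c)` -/
noncomputable def q₂ : ℂ := 62 / 5 - 7 / 2 * c
/-- Horner coefficient `q₁ = −369/25 + q₂·c` of the quotient `D₂` -/
noncomputable def q₁ : ℂ := -369 / 25 + q₂ * c
/-- Horner coefficient `q₀ = 918/125 + q₁·c` of the quotient `D₂` -/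
noncomputable def q₀ : ℂ := 918 / 125 + q₁ * c

/-- the cubic quotient `D₂` -/
noncomputable def D₂ (z : ℂ) : ℂ := ((-7 / 2 * z + q₂) * z + q₁) * z + q₀

/-- Taylor coefficients of `D₂` at `c` -/
noncomputable def a₀ : ℂ := D₂ c
/-- Taylor coefficient `a₁ = D₂′(c)` -/
noncomputable def a₁ : ℂ := (-21 / 2 * c + 2 * q₂) * c + q₁
/-- Taylor coefficient `a₂ = D₂″(c)/2` -/
noncomputable def a₂ : ℂ := -21 / 2 * c + q₂

/-- the Rouché comparison function `g = (z − c)·e^{−7z/2}·D₂` -/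
noncomputable def g (z : ℂ) : ℂ := (z - c) * (cexp (-7 / 2 * z) * D₂ z)

/-- synthetic division: `D z = (z − c)·D₂ z + D c` (a `ring` identity, the coefficients being defined from `c`). -/
theorem D_split (z : ℂ) : D z = (z - c) * D₂ z + D c := by
  simp only [D, D₂, q₂, q₁, q₀]; ring

/-- Taylor (Horner) form of `D₂` at `c`: `D₂ z = a₀ + (z − c)(a₁ + (z − c)(a₂ − (7/2)(z − c)))`. -/
theorem D₂_taylor (z : ℂ) : D₂ z = a₀ + (z - c) * (a₁ + (z - c) * (a₂ + (z - c) * (-7 / 2))) := by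
  simp only [D₂, a₀, a₁, a₂, q₂, q₁, q₀]; ring

/-- `F₀′(z) = e^{−7z/2}·D(z)`. -/
theorem hasDerivAt_F₀ (z : ℂ) : HasDerivAt F₀ (cexp (-7 / 2 * z) * D z) z := by
  have h1 : HasDerivAt (fun z : ℂ => z ^ 2 + 9 / 25) (2 * z) z := by
    simpa using (hasDerivAt_pow 2 z).add_const (9 / 25 : ℂ)
  have h2 : HasDerivAt (fun z : ℂ => (z - 6 / 5) ^ 2 + 9 / 25) (2 * (z - 6 / 5)) z := by
    simpa using (((hasDerivAt_id z).sub_const (6 / 5 : ℂ)).pow 2).add_const (9 / 25 : ℂ)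
  have hP : HasDerivAt P (2 * z * ((z - 6 / 5) ^ 2 + 9 / 25) + (z ^ 2 + 9 / 25) * (2 * (z - 6 / 5))) z := h1.mul h2
  have hE : HasDerivAt (fun z : ℂ => cexp (-7 / 2 * z)) (cexp (-7 / 2 * z) * (-7 / 2)) z := by
    simpa using ((hasDerivAt_id z).const_mul (-7 / 2 : ℂ)).cexp
  have hF : HasDerivAt F₀ (cexp (-7 / 2 * z) * (-7 / 2) * P z +
      cexp (-7 / 2 * z) * (2 * z * ((z - 6 / 5) ^ 2 + 9 / 25) + (z ^ 2 + 9 / 25) * (2 * (z - 6 / 5)))) z := hE.mul hP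
  refine hF.congr_deriv ?_
  simp only [P, D]; ring

/-- `deriv F₀ = e^{−7z/2}·D` as functions. -/
theorem deriv_F₀ : deriv F₀ = fun z => cexp (-7 / 2 * z) * D z := funext fun z => (hasDerivAt_F₀ z).deriv

/-- `F₀` is entire. -/
theorem differentiable_F₀ : Differentiable ℂ F₀ := fun z => (hasDerivAt_F₀ z).differentiableAt

/-- `D` is entire. -/
theorem differentiable_D : Differentiable ℂ D := by unfold D; fun_prop

/-- `D₂` is entire. -/
theorem differentiable_D₂ : Differentiable ℂ D₂ := by unfold D₂; fun_prop

/-- the tilt `e^{−7z/2}` is entire. -/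
theorem differentiable_expTilt : Differentiable ℂ (fun z : ℂ => cexp (-7 / 2 * z)) :=
  (differentiable_id.const_mul _).cexp

/-- `F₀′` is entire. -/
theorem differentiable_deriv_F₀ : Differentiable ℂ (deriv F₀) := by
  rw [deriv_F₀]; exact differentiable_expTilt.mul differentiable_D

/-- the comparison function `g` is entire. -/
theorem differentiable_g : Differentiable ℂ g := by
  unfold g; exact (differentiable_id.sub_const _).mul (differentiable_expTilt.mul differentiable_D₂)

/-! ## 2. The exact rational values -/

/-- `Re c = 1/5` -/
theorem c_re : c.re = 1 / 5 := rfl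
/-- `Im c = 11/20` -/
theorem c_im : c.im = 11 / 20 := rfl

/-- `Re a₀ = −737/125` (exact) -/
theorem a₀_re : a₀.re = -737 / 125 := by
  simp [a₀, D₂, q₂, q₁, q₀, c]; norm_num
/-- `Im a₀ = −26587/4000` (exact) -/
theorem a₀_im : a₀.im = -26587 / 4000 := by
  simp [a₀, D₂, q₂, q₁, q₀, c]; norm_num
/-- `Re a₁ = −723/400` (exact) -/
theorem a₁_re : a₁.re = -723 / 400 := by
  simp [a₁, q₂, q₁, c]; norm_num
/-- `Im a₁ = 396/25` (exact) -/
theorem a₁_im : a₁.im = 396 / 25 := by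
  simp [a₁, q₂, q₁, c]; norm_num
/-- `Re a₂ = 48/5` (exact) -/
theorem a₂_re : a₂.re = 48 / 5 := by
  simp [a₂, q₂, c]; norm_num
/-- `Im a₂ = −77/10` (exact) -/
theorem a₂_im : a₂.im = -77 / 10 := by
  simp [a₂, q₂, c]; norm_num

/-- the remainder `D c = q₀·c − 783/250` (a `ring` identity). -/
theorem Dc_eq : D c = q₀ * c - 783 / 250 := by
  simp only [D, q₂, q₁, q₀]; ring
/-- `Re (D c) = −3799/320000` (exact) -/
theorem Dc_re : (D c).re = -3799 / 320000 := by
  rw [Dc_eq]; simp [q₂, q₁, q₀, c]; norm_num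
/-- `Im (D c) = −121/2500` (exact) -/
theorem Dc_im : (D c).im = -121 / 2500 := by
  rw [Dc_eq]; simp [q₂, q₁, q₀, c]; norm_num

/-- `‖z‖` from below / above via the components -/
theorem le_norm_of_sq_le {z : ℂ} {b : ℝ} (_hb : 0 ≤ b) (h : b ^ 2 ≤ z.re * z.re + z.im * z.im) : b ≤ ‖z‖ := by
  have h2 : b ^ 2 ≤ ‖z‖ ^ 2 := by rw [Complex.sq_norm, Complex.normSq_apply]; exact h
  nlinarith [norm_nonneg z]

/-- `‖z‖ ≤ b` from `Re² + Im² ≤ b²` -/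
theorem norm_le_of_sq_le {z : ℂ} {b : ℝ} (_hb : 0 ≤ b) (h : z.re * z.re + z.im * z.im ≤ b ^ 2) : ‖z‖ ≤ b := by
  have h2 : ‖z‖ ^ 2 ≤ b ^ 2 := by rw [Complex.sq_norm, Complex.normSq_apply]; exact h
  nlinarith [norm_nonneg z]

/-- `‖a₀‖ ≥ 8` -/
theorem norm_a₀ : 8 ≤ ‖a₀‖ := le_norm_of_sq_le (by norm_num) (by rw [a₀_re, a₀_im]; norm_num)
/-- `‖a₁‖ ≤ 16` -/
theorem norm_a₁ : ‖a₁‖ ≤ 16 := norm_le_of_sq_le (by norm_num) (by rw [a₁_re, a₁_im]; norm_num)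
/-- `‖a₂‖ ≤ 13` -/
theorem norm_a₂ : ‖a₂‖ ≤ 13 := norm_le_of_sq_le (by norm_num) (by rw [a₂_re, a₂_im]; norm_num)
/-- `‖D c‖ ≤ 1/20` -/
theorem norm_Dc : ‖D c‖ ≤ 1 / 20 := norm_le_of_sq_le (by norm_num) (by rw [Dc_re, Dc_im]; norm_num)

/-! ## 3. The certificate: `‖D₂‖ > 7` on the closed disc, hence Rouché domination on the circle -/

/-- ★ the closed-disc lower bound: `‖z − c‖ ≤ 1/25 → 7 < ‖D₂ z‖` (from `‖a₀‖ − ‖w‖(‖a₁‖ + ‖w‖(‖a₂‖ + (7/2)‖w‖)) ≥ 8 − 0.661`). -/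
theorem norm_D₂_gt (z : ℂ) (hz : ‖z - c‖ ≤ 1 / 25) : 7 < ‖D₂ z‖ := by
  have hT := D₂_taylor z
  set w : ℂ := z - c with hw
  have hw0 : 0 ≤ ‖w‖ := norm_nonneg w
  have h72 : ‖(-7 / 2 : ℂ)‖ = 7 / 2 := by simp
  -- inner: ‖a₂ + w·(−7/2)‖ ≤ 13 + (1/25)(7/2)
  have h3 : ‖a₂ + w * (-7 / 2)‖ ≤ 13 + 1 / 25 * (7 / 2) := by
    calc ‖a₂ + w * (-7 / 2)‖ ≤ ‖a₂‖ + ‖w * (-7 / 2 : ℂ)‖ := norm_add_le _ _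
      _ = ‖a₂‖ + ‖w‖ * (7 / 2) := by rw [norm_mul, h72]
      _ ≤ 13 + 1 / 25 * (7 / 2) := by nlinarith [norm_a₂]
  have h2 : ‖a₁ + w * (a₂ + w * (-7 / 2))‖ ≤ 16 + 1 / 25 * (13 + 1 / 25 * (7 / 2)) := by
    calc ‖a₁ + w * (a₂ + w * (-7 / 2))‖ ≤ ‖a₁‖ + ‖w * (a₂ + w * (-7 / 2))‖ := norm_add_le _ _
      _ = ‖a₁‖ + ‖w‖ * ‖a₂ + w * (-7 / 2)‖ := by rw [norm_mul]
      _ ≤ 16 + 1 / 25 * (13 + 1 / 25 * (7 / 2)) := by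
          nlinarith [norm_a₁, h3, norm_nonneg (a₂ + w * (-7 / 2)), mul_le_mul hz h3 (norm_nonneg _) (by norm_num : (0:ℝ) ≤ 1 / 25)]
  have h1 : ‖w * (a₁ + w * (a₂ + w * (-7 / 2)))‖ ≤ 1 / 25 * (16 + 1 / 25 * (13 + 1 / 25 * (7 / 2))) := by
    rw [norm_mul]; exact mul_le_mul hz h2 (norm_nonneg _) (by norm_num)
  have h0 : ‖a₀‖ ≤ ‖D₂ z‖ + ‖w * (a₁ + w * (a₂ + w * (-7 / 2)))‖ := by
    have e : a₀ = D₂ z - w * (a₁ + w * (a₂ + w * (-7 / 2))) := by rw [hT]; ring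
    rw [e]; exact norm_sub_le _ _
  linarith [norm_a₀]

/-- `g` vanishes on the closed disc only at `c`. -/
theorem g_ne_zero_of_ne (z : ℂ) (hz : ‖z - c‖ ≤ 1 / 25) (hzc : z ≠ c) : g z ≠ 0 := by
  have hD₂ : D₂ z ≠ 0 := by
    intro h; have := norm_D₂_gt z hz; rw [h, norm_zero] at this; linarith
  unfold g
  exact mul_ne_zero (sub_ne_zero.mpr hzc) (mul_ne_zero (Complex.exp_ne_zero _) hD₂)

/-- ★ Rouché domination on the circle `‖z − c‖ = 1/25`: `‖F₀′ − g‖ = ‖e^{−7z/2}‖·‖D c‖ < (1/25)·‖e^{−7z/2}‖·‖D₂ z‖ = ‖g z‖`. -/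
theorem dom_circle (z : ℂ) (hz : ‖z - c‖ = 1 / 25) : ‖deriv F₀ z - g z‖ < ‖g z‖ := by
  have hdef : deriv F₀ z - g z = cexp (-7 / 2 * z) * D c := by
    rw [deriv_F₀]; simp only [g]; rw [D_split z]; ring
  have hexp : 0 < ‖cexp (-7 / 2 * z)‖ := norm_pos_iff.mpr (Complex.exp_ne_zero _)
  have hD₂ := norm_D₂_gt z hz.le
  rw [hdef, norm_mul, g, norm_mul, norm_mul, hz]
  nlinarith [norm_Dc, hexp, hD₂]

/-! ## 4. The child of E2 in the disc, and the level-1 band state -/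

/-- ★★ `F₀′` has exactly one zero in the closed disc `‖z − c‖ ≤ 1/25`; it is simple and lies in the open disc. -/
theorem exists_child : ∃ u : ℂ, ‖u - c‖ < 1 / 25 ∧ deriv F₀ u = 0 ∧ deriv (deriv F₀) u ≠ 0 ∧
    ∀ v ∈ closedBall c (1 / 25), deriv F₀ v = 0 → v = u := by
  have hE : Differentiable ℂ (fun z : ℂ => cexp (-7 / 2 * z) * D₂ z) := differentiable_expTilt.mul differentiable_D₂
  -- `g' (c) = e^{−7c/2}·D₂ c ≠ 0`
  have hgd : HasDerivAt g (1 * (cexp (-7 / 2 * c) * D₂ c) + (c - c) * deriv (fun z : ℂ => cexp (-7 / 2 * z) * D₂ z) c) c := by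
    unfold g; exact ((hasDerivAt_id c).sub_const c).mul (hE c).hasDerivAt
  have hg1 : deriv g c ≠ 0 := by
    rw [hgd.deriv, sub_self, zero_mul, add_zero, one_mul]
    refine mul_ne_zero (Complex.exp_ne_zero _) ?_
    intro h
    have h8 := norm_a₀
    rw [a₀, h, norm_zero] at h8; linarith
  have hg0 : g c = 0 := by simp [g]
  have huniq : ∀ v ∈ closedBall c (1 / 25 : ℝ), g v = 0 → v = c := by
    intro v hv hgv
    by_contra hvc
    have hv' : ‖v - c‖ ≤ 1 / 25 := by rwa [mem_closedBall, dist_eq_norm] at hv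
    exact g_ne_zero_of_ne v hv' hvc hgv
  exact Rouche.existsUnique_zero_of_norm_sub_lt (f := deriv F₀) (g := g) (c := c) (ρ := 1) (r := 1 / 25)
    (by norm_num) (by norm_num) differentiable_deriv_F₀.differentiableOn differentiable_g.differentiableOn
    dom_circle (mem_closedBall_self (by norm_num)) hg0 hg1 huniq

/-- `F₀′ ≢ 0` (its value at `0` is `D 0 = −783/250`). -/
theorem deriv_F₀_ne_zero : deriv F₀ ≠ 0 := by
  intro h
  have h0 := congrFun h 0
  rw [deriv_F₀] at h0
  simp [D] at h0

/-- ★★★ THE E2 REPLAY: the tilted two-pair frame `F₀` has a LEVEL-1 BAND STATE (for every `η s hmax B`; the band class `StTrkDQ = StColQ'`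
reads only `f, x₀ = 0, R = 2, Hs = 3/5, j = 1`): the child `u` of the pair `±3i/5` under the tilt, `‖u − (1/5 + 11i/20)‖ < 1/25`. -/
theorem E2_levelOne_bandState (η s hmax : ℝ) (B : ℕ) : ∃ u : ℂ, StTrkDQ η F₀ 0 s hmax 2 (3 / 5) B 1 u := by
  obtain ⟨u, huc, hu, -, -⟩ := exists_child
  have hre : |u.re - 1 / 5| < 1 / 25 := by
    have h := Complex.abs_re_le_norm (u - c); rw [sub_re, c_re] at h; linarith
  have him : |u.im - 11 / 20| < 1 / 25 := by
    have h := Complex.abs_im_le_norm (u - c); rw [sub_im, c_im] at h; linarith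
  obtain ⟨hre1, hre2⟩ := abs_lt.mp hre
  obtain ⟨him1, him2⟩ := abs_lt.mp him
  have hmx : max (|u.re - 0| - 2 / 2) 0 = 0 := by
    apply max_eq_right
    have : |u.re - 0| < 1 := by rw [sub_zero]; exact abs_lt.mpr ⟨by linarith, by linarith⟩
    linarith
  refine ⟨u, ?_, ?_, ?_, ?_, ?_⟩
  · rw [iteratedDeriv_one]; exact deriv_F₀_ne_zero
  · rw [iteratedDeriv_one]; exact hu
  · linarith
  · rw [hmx]; push_cast; nlinarith
  · linarith

end RhW08.E2Replay
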